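/-
COR-CM (cell pub-hodgecm2, stage 2 of the Hodge ladder) — count-neutral kernel census (seat prover-pub-hodgecm2-b23-g37-0, binder
prover b23, gen 37; claim EVEN-SLICE F6, blanket `Census/EvenSlice*` (lead gen 10, HOME/INBOX.md l.8803); sequel of
`Census/EvenSliceFacesGenerate.lean`).  Two bookkeeping definitions (`orbSet`, `parVec` — the orbit parities) + theorems, in seat b09's
representative-free model of the faithful full slice of `(ℤ/2 × A, (1,0))`; no `decide` table, no certificate, no named fact, no
geometry, no `sorry`.  `Interfaces.lean` (C1), every E term, B01 and `Transposition/*` are untouched.  HC_CM is NOT proved anywhere in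
this cell; nothing here is a headline and nothing here produces a period.
-/
import Summits.HodgeConjecture.CorCM.Census.EvenSliceFacesGenerate

/-!
# The even-slice law: NO family of fewer than `#OrbitsA A − 1` Galois orbits generates — so `μ(ℤ/2 × A, (1,0)) = #OrbitsA A − 1` for
# `|A|` even, attained by the canonical squares

THE LAW (**`card_orbitsA_le_card_add_one`**, every finite abelian `A`).  In seat b09's representative-free model of the faithful full
slice of `(ℤ/2 × A, (1,0))`: if a finite family `S` of exponent vectors generates the Hodge lattice together with the divisor pairs and
all Galois translates — `hodge A ≤ pairs A ⊔ ℤ⟨transl g v : g ∈ ℤ/2 × A, v ∈ S⟩` — then `#OrbitsA A ≤ |S| + 1`.  With part F2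
(`hodge_le_pairs_sup_spanFaces_squares_of_even`, `card_squares_add_one`) this is an EQUALITY for `|A|` even (**`evenSlice_law_eq`**):
the least number of Galois orbits of Hodge generators modulo divisor classes of the faithful full slice of a Galois CM field with group
`ℤ/2 × A`, `|A|` even, is EXACTLY `#OrbitsA A − 1` = (number of isogeny classes of simple CM abelian varieties other than `E` split by
the field) `− 1`, and rank-four FACE classes (the canonical squares) achieve it.  (For `|A|` odd seat b17's `oddSlice_law` is sharper
by one — `#OrbitsA A`, the closing face being necessary — and this file's bound is not used there.)  This is the instance
`G = ℤ/2 × A` of seat b09's block-parity floor (`Census/BlockParityRelations.lean` `card_block_le_card_add`, `δ = 1`), proved here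
inside the `Ty A` model so that the even-slice lane is self-contained.

PROOF (kernel).  The ORBIT PARITIES `parVec m = (Σ_{ψ ∈ ω} m(ψ) mod 2)_{ω}` form a `ℤ`-linear map to `𝔽₂^{OrbitsA A}` killing the
pairs (`ψ`, `ψ + 1` lie in the same orbit) and invariant under Galois translation (orbits are `G`-stable); so the parities of
`pairs ⊔ ℤ[G]·S` span an `𝔽₂`-space of dimension `≤ |S|`.  On the other hand the parity vector of the canonical square of a simple
factor `ω` of class `k ≥ 2` is `e_ω +` (terms at factors of class `< k`) — the other three corners have smaller class (part F1) — so
the `#OrbitsA A − 1` parity vectors of the canonical squares are UNITRIANGULAR for the class order, hence linearly independent over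
`𝔽₂`, and they lie in the image of the Hodge lattice.  All [folklore].

## References
* [Pohlmann1968] H. Pohlmann, Algebraic cycles on abelian varieties of complex multiplication type, Ann. of Math. 88 (1968), Thm 1.
* [Milne1999] J. S. Milne, Lefschetz motives and the Tate conjecture, Compositio Math. 117 (1999), Prop. 2.1, p. 54.
-/

namespace Summit.HodgeConjecture.CorCM.Census.EvenSliceLaw

open Finset
open Summit.HodgeConjecture.CorCM.Census.OddSliceFacesModel
open Summit.HodgeConjecture.CorCM.Census.OddSliceFacesSquares
open Summit.HodgeConjecture.CorCM.Census.OddSliceFacesDescent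
open Summit.HodgeConjecture.CorCM.Census.OddSliceFacesCount
open Summit.HodgeConjecture.CorCM.Census.EvenSliceFacesDescent
open Summit.HodgeConjecture.CorCM.Census.EvenSliceFacesGenerate

variable (A : Type) [AddCommGroup A] [Fintype A] [DecidableEq A]

/-! ## §1 Orbit sets and orbit parities -/

/-- The labels of the simple factor `ω` (the nonconstant types in the `G`-orbit `ω`), as a finite set. [folklore] -/
noncomputable def orbSet (ω : OddDegreeParityLaw.OrbitsA A) : Finset (Ty A) :=
  univ.filter fun ψ => ∃ h : ¬ ∀ y, ψ y = ψ 0, (Quotient.mk _ (⟨ψ, h⟩ : OddDegreeParityLaw.Nonconst A) : OddDegreeParityLaw.OrbitsA A) = ω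

/-- Membership in `orbSet`. [folklore] -/
theorem mem_orbSet {ω : OddDegreeParityLaw.OrbitsA A} {ψ : Ty A} :
    ψ ∈ orbSet A ω ↔ ∃ h : ¬ ∀ y, ψ y = ψ 0,
      (Quotient.mk _ (⟨ψ, h⟩ : OddDegreeParityLaw.Nonconst A) : OddDegreeParityLaw.OrbitsA A) = ω := by
  unfold orbSet
  simp only [Finset.mem_filter, Finset.mem_univ, true_and]

/-- A label of `ω` has the defect class of `ω`. [folklore] -/
theorem clsTy_of_mem_orbSet {ω : OddDegreeParityLaw.OrbitsA A} {ψ : Ty A} (h : ψ ∈ orbSet A ω) : clsTy A ψ = cls A ω := by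
  obtain ⟨hnc, hω⟩ := (mem_orbSet A).mp h
  rw [← hω, cls_mk]

/-- Twists preserve orbit sets. [folklore] -/
theorem tw_mem_orbSet_iff (g : ZMod 2 × A) {ω : OddDegreeParityLaw.OrbitsA A} {ψ : Ty A} :
    tw A g ψ ∈ orbSet A ω ↔ ψ ∈ orbSet A ω := by
  -- `tw g` is b17's action by `(g.1, −g.2)` on nonconstant types
  have key : ∀ (g : ZMod 2 × A) (ψ : Ty A), ψ ∈ orbSet A ω → tw A g ψ ∈ orbSet A ω := by
    intro g ψ h
    obtain ⟨hnc, hω⟩ := (mem_orbSet A).mp h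
    have hnc' : ¬ ∀ y, tw A g ψ y = tw A g ψ 0 := by
      have e : tw A g ψ = ((g.1, -g.2) +ᵥ (⟨ψ, hnc⟩ : OddDegreeParityLaw.Nonconst A)).1 := by
        rw [vadd_val_eq_tw]; simp
      rw [e]; exact ((g.1, -g.2) +ᵥ (⟨ψ, hnc⟩ : OddDegreeParityLaw.Nonconst A)).2
    refine (mem_orbSet A).mpr ⟨hnc', ?_⟩
    rw [← hω]
    refine Quotient.sound (AddAction.orbitRel_apply.mpr (AddAction.mem_orbit_iff.mpr ⟨(g.1, -g.2), ?_⟩))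
    apply Subtype.ext
    rw [vadd_val_eq_tw]
    simp
  refine ⟨fun h => ?_, key g ψ⟩
  have := key (-g) _ h
  rwa [tw_neg_tw] at this

/-- Conjugation preserves orbit sets. [folklore] -/
theorem add_one_mem_orbSet_iff {ω : OddDegreeParityLaw.OrbitsA A} {ψ : Ty A} : ψ + 1 ∈ orbSet A ω ↔ ψ ∈ orbSet A ω := by
  rw [← tw_one_zero]; exact tw_mem_orbSet_iff A (1, 0)

/-- **The orbit parities** `parVec m = (Σ_{ψ ∈ ω} m(ψ) mod 2)_ω`, a `ℤ`-linear map to `𝔽₂^{OrbitsA A}`. [folklore] -/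
noncomputable def parVec : (Ty A → ℤ) →ₗ[ℤ] (OddDegreeParityLaw.OrbitsA A → ZMod 2) where
  toFun m := fun ω => ∑ ψ ∈ orbSet A ω, (m ψ : ZMod 2)
  map_add' m m' := by
    funext ω
    simp only [Pi.add_apply, Int.cast_add, Finset.sum_add_distrib]
  map_smul' c m := by
    funext ω
    simp only [Pi.smul_apply, smul_eq_mul, Int.cast_mul, RingHom.id_apply, Finset.mul_sum, zsmul_eq_mul]

/-- `parVec` evaluated. [folklore] -/
theorem parVec_apply (m : Ty A → ℤ) (ω : OddDegreeParityLaw.OrbitsA A) :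
    parVec A m ω = ∑ ψ ∈ orbSet A ω, (m ψ : ZMod 2) := rfl

/-- `parVec` of a unit vector: the indicator of the orbit of its label. [folklore] -/
theorem parVec_single (χ : Ty A) (c : ℤ) (ω : OddDegreeParityLaw.OrbitsA A) :
    parVec A (Pi.single χ c) ω = if χ ∈ orbSet A ω then (c : ZMod 2) else 0 := by
  rw [parVec_apply]
  have hterm : ∀ ψ ∈ orbSet A ω, ((Pi.single χ c : Ty A → ℤ) ψ : ZMod 2) = if χ = ψ then (c : ZMod 2) else 0 := by
    intro ψ _
    rw [Pi.single_apply]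
    by_cases h : ψ = χ
    · rw [if_pos h, if_pos h.symm]
    · rw [if_neg h, if_neg (Ne.symm h), Int.cast_zero]
  rw [Finset.sum_congr rfl hterm, Finset.sum_ite_eq]

/-- **`parVec` kills the pairs** (`ψ` and `ψ + 1` lie in the same orbit). [folklore] -/
theorem parVec_pairVec (ψ : Ty A) : parVec A (pairVec A ψ) = 0 := by
  funext ω
  unfold pairVec
  rw [map_add, Pi.add_apply, parVec_single, parVec_single, Pi.zero_apply]
  by_cases h : ψ ∈ orbSet A ω
  · rw [if_pos h, if_pos ((add_one_mem_orbSet_iff A).mpr h), Int.cast_one]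
    decide
  · rw [if_neg h, if_neg (fun h' => h ((add_one_mem_orbSet_iff A).mp h')), add_zero]

/-- **`parVec` is invariant under Galois translation** (orbits are `G`-stable). [folklore] -/
theorem parVec_transl (g : ZMod 2 × A) (v : Ty A → ℤ) : parVec A (transl A g v) = parVec A v := by
  funext ω
  rw [parVec_apply, parVec_apply]
  -- reindex the sum by the permutation `tw (−g)` of `orbSet ω`
  refine Finset.sum_bij (fun ψ _ => tw A (-g) ψ) (fun ψ hψ => (tw_mem_orbSet_iff A (-g)).mpr hψ) ?_ ?_ (fun ψ _ => rfl)
  · intro ψ₁ _ ψ₂ _ h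
    have := congrArg (tw A g) h
    rwa [tw_tw_neg, tw_tw_neg] at this
  · intro χ hχ
    exact ⟨tw A g χ, (tw_mem_orbSet_iff A g).mpr hχ, tw_neg_tw A g χ⟩

/-! ## §2 The parities of a generating family bound everything -/

/-- The `𝔽₂`-span of the parities of a family `S`. [folklore] -/
theorem parVec_mem_span_of_mem (S : Finset (Ty A → ℤ)) {m : Ty A → ℤ}
    (hm : m ∈ pairs A ⊔ Submodule.span ℤ {w : Ty A → ℤ | ∃ g : ZMod 2 × A, ∃ v ∈ S, w = transl A g v}) :
    parVec A m ∈ Submodule.span (ZMod 2) ((S.image (parVec A) : Finset _) : Set (OddDegreeParityLaw.OrbitsA A → ZMod 2)) := by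
  set T := Submodule.span (ZMod 2) ((S.image (parVec A) : Finset _) : Set (OddDegreeParityLaw.OrbitsA A → ZMod 2)) with hT
  have hle : pairs A ⊔ Submodule.span ℤ {w : Ty A → ℤ | ∃ g : ZMod 2 × A, ∃ v ∈ S, w = transl A g v} ≤
      (T.restrictScalars ℤ).comap (parVec A) := by
    refine sup_le (Submodule.span_le.mpr ?_) (Submodule.span_le.mpr ?_)
    · rintro _ ⟨ψ, rfl⟩
      show parVec A (pairVec A ψ) ∈ T
      rw [parVec_pairVec]; exact T.zero_mem
    · rintro _ ⟨g, v, hv, rfl⟩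
      show parVec A (transl A g v) ∈ T
      rw [parVec_transl]
      exact Submodule.subset_span (Finset.mem_coe.mpr (Finset.mem_image_of_mem _ hv))
  exact hle hm

/-! ## §3 The parities of the canonical squares are unitriangular for the class order -/

/-- The parity vector of the canonical square of `ω`: `1` at `ω`, and `0` at every `ω' ≠ ω` of class `≥ cls ω`. [folklore] -/
theorem parVec_sqFace (ω ω' : OddDegreeParityLaw.OrbitsA A) (h2 : 2 ≤ cls A ω) :
    parVec A (faceVec A (sqFace A ω).1 (sqFace A ω).2.1 (sqFace A ω).2.2) ω' =
      if ω' = ω then 1 else (if cls A ω' < cls A ω then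
        parVec A (faceVec A (sqFace A ω).1 (sqFace A ω).2.1 (sqFace A ω).2.2) ω' else 0) := by
  have hrep2 : 2 ≤ wt A (rep A ω) := by rw [wt_rep]; exact h2
  obtain ⟨hij, hi, hj⟩ := pick_spec A hrep2
  -- classes of the four corners
  have c1 : ∀ {ω'' : OddDegreeParityLaw.OrbitsA A}, rep A ω ∈ orbSet A ω'' → ω'' = ω := by
    intro ω'' h
    obtain ⟨hnc, hω''⟩ := (mem_orbSet A).mp h
    rw [← hω'']
    exact mk_rep A ω
  have c2 : ∀ {ω'' : OddDegreeParityLaw.OrbitsA A}, rep A ω + 1 + δ A (pick A (rep A ω)).1 ∈ orbSet A ω'' → cls A ω'' < cls A ω := by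
    intro ω'' h
    have := clsTy_of_mem_orbSet A h
    have b := clsTy_corner_bar_le A hi
    rw [wt_rep] at b; omega
  have c3 : ∀ {ω'' : OddDegreeParityLaw.OrbitsA A}, rep A ω + 1 + δ A (pick A (rep A ω)).2 ∈ orbSet A ω'' → cls A ω'' < cls A ω := by
    intro ω'' h
    have := clsTy_of_mem_orbSet A h
    have b := clsTy_corner_bar_le A hj
    rw [wt_rep] at b; omega
  have c4 : ∀ {ω'' : OddDegreeParityLaw.OrbitsA A},
      rep A ω + δ A (pick A (rep A ω)).1 + δ A (pick A (rep A ω)).2 ∈ orbSet A ω'' → cls A ω'' < cls A ω := by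
    intro ω'' h
    have := clsTy_of_mem_orbSet A h
    have b := clsTy_corner_flip_le A hi hj hij
    rw [wt_rep] at b; omega
  have hrepmem : rep A ω ∈ orbSet A ω := (mem_orbSet A).mpr ⟨rep_nonconst A ω, mk_rep A ω⟩
  show parVec A (faceVec A (rep A ω) (pick A (rep A ω)).1 (pick A (rep A ω)).2) ω' = _
  by_cases hω : ω' = ω
  · rw [if_pos hω, hω]
    unfold faceVec
    rw [map_add, map_add, map_add, Pi.add_apply, Pi.add_apply, Pi.add_apply, parVec_single, parVec_single, parVec_single,
      parVec_single, if_pos hrepmem, if_neg (fun h => lt_irrefl _ (c2 h)), if_neg (fun h => lt_irrefl _ (c3 h)),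
      if_neg (fun h => lt_irrefl _ (c4 h)), Int.cast_one]
    ring
  · rw [if_neg hω]
    by_cases hlt : cls A ω' < cls A ω
    · rw [if_pos hlt]; rfl
    · rw [if_neg hlt]
      unfold faceVec
      rw [map_add, map_add, map_add, Pi.add_apply, Pi.add_apply, Pi.add_apply, parVec_single, parVec_single, parVec_single,
        parVec_single, if_neg (fun h => hω (c1 h)), if_neg (fun h => hlt (c2 h)), if_neg (fun h => hlt (c3 h)),
        if_neg (fun h => hlt (c4 h))]
      ring

/-- **The parity vectors of the canonical squares are linearly independent over `𝔽₂`** (unitriangular for the class order).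
[folklore] -/
theorem linearIndependent_parVec_squares :
    LinearIndependent (ZMod 2) (fun ω : {ω : OddDegreeParityLaw.OrbitsA A // 2 ≤ cls A ω} =>
      parVec A (faceVec A (sqFace A ω.1).1 (sqFace A ω.1).2.1 (sqFace A ω.1).2.2)) := by
  rw [linearIndependent_iff']
  intro s g hsum
  -- if some coefficient is non-zero, take one of maximal class and evaluate there
  by_contra hne
  simp only [not_forall] at hne
  obtain ⟨i₁, hi₁s, hi₁⟩ := hne
  set s' := s.filter fun i => g i ≠ 0 with hs'
  have hs'ne : s'.Nonempty := ⟨i₁, Finset.mem_filter.mpr ⟨hi₁s, hi₁⟩⟩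
  obtain ⟨i₀, hi₀, hmax⟩ := Finset.exists_max_image s' (fun i => cls A i.1) hs'ne
  obtain ⟨hi₀s, hgi₀⟩ := Finset.mem_filter.mp hi₀
  have heval := congrFun hsum i₀.1
  rw [Finset.sum_apply, Pi.zero_apply] at heval
  have hterm : ∀ i ∈ s, (g i • parVec A (faceVec A (sqFace A i.1).1 (sqFace A i.1).2.1 (sqFace A i.1).2.2)) i₀.1 =
      if i = i₀ then g i₀ else 0 := by
    intro i hi
    rw [Pi.smul_apply, smul_eq_mul, parVec_sqFace A i.1 i₀.1 i.2]
    by_cases hii : i = i₀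
    · rw [if_pos hii, hii, if_pos rfl, mul_one]
    · rw [if_neg hii]
      have hne' : i₀.1 ≠ i.1 := fun h => hii (Subtype.ext h.symm)
      rw [if_neg hne']
      by_cases hgi : g i = 0
      · rw [hgi, zero_mul]
      · have hle : cls A i.1 ≤ cls A i₀.1 := hmax i (Finset.mem_filter.mpr ⟨hi, hgi⟩)
        rw [if_neg (not_lt.mpr hle), mul_zero]
  rw [Finset.sum_congr rfl hterm, Finset.sum_ite_eq' s i₀, if_pos hi₀s] at heval
  exact hgi₀ heval

/-! ## §4 The law -/

/-- **THE LAW (lower bound, every finite abelian `A`).**  If a finite family `S` of exponent vectors generates the Hodge lattice of the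
faithful full slice of `(ℤ/2 × A, (1,0))` together with the divisor pairs and all Galois translates, then `#OrbitsA A ≤ |S| + 1`.
[folklore] -/
theorem card_orbitsA_le_card_add_one (S : Finset (Ty A → ℤ))
    (hS : hodge A ≤ pairs A ⊔ Submodule.span ℤ {w : Ty A → ℤ | ∃ g : ZMod 2 × A, ∃ v ∈ S, w = transl A g v}) :
    Fintype.card (OddDegreeParityLaw.OrbitsA A) ≤ S.card + 1 := by
  classical
  by_cases h1 : Fintype.card A ≤ 1
  · -- `|A| = 1`: no simple factor other than `E`
    haveI := isEmpty_orbitsA_of_card_eq_one A (le_antisymm h1 Fintype.card_pos)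
    rw [Fintype.card_eq_zero]; exact Nat.zero_le _
  · rw [← card_squares_add_one A (by omega), squares_card, Nat.add_le_add_iff_right]
    set T := Submodule.span (ZMod 2) ((S.image (parVec A) : Finset _) : Set (OddDegreeParityLaw.OrbitsA A → ZMod 2)) with hT
    -- the independent family lands in `T`
    have hmem : ∀ ω : {ω : OddDegreeParityLaw.OrbitsA A // 2 ≤ cls A ω},
        parVec A (faceVec A (sqFace A ω.1).1 (sqFace A ω.1).2.1 (sqFace A ω.1).2.2) ∈ T := by
      intro ω
      refine parVec_mem_span_of_mem A S (hS ?_)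
      have h2 : 2 ≤ wt A (rep A ω.1) := by rw [wt_rep]; exact ω.2
      exact faceVec_mem A _ (pick_spec A h2).1
    have hli := linearIndependent_parVec_squares A
    have hli' : LinearIndependent (ZMod 2) (fun ω : {ω : OddDegreeParityLaw.OrbitsA A // 2 ≤ cls A ω} =>
        (⟨_, hmem ω⟩ : T)) := LinearIndependent.of_comp T.subtype hli
    have hcard := hli'.fintype_card_le_finrank
    have hT' : Module.finrank (ZMod 2) T ≤ S.card :=
      (finrank_span_finset_le_card _).trans Finset.card_image_le
    have hsub : (univ.filter fun ω : OddDegreeParityLaw.OrbitsA A => 2 ≤ cls A ω).card =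
        Fintype.card {ω : OddDegreeParityLaw.OrbitsA A // 2 ≤ cls A ω} := (Fintype.card_subtype _).symm
    rw [hsub]
    exact hcard.trans hT'

/-- **THE EVEN-SLICE LAW.**  For every finite abelian group `A` of EVEN order: (i) the canonical squares — `#OrbitsA A − 1` rank-four face
classes — generate the Hodge lattice of the faithful full slice of `(ℤ/2 × A, (1,0))` together with the pairs and Galois translation, and
(ii) no family of fewer exponent vectors of any kind does: `μ(ℤ/2 × A, (1,0)) = #OrbitsA A − 1` EXACTLY. [folklore] -/
theorem evenSlice_law_eq (hA : Even (Fintype.card A)) :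
    (hodge A ≤ pairs A ⊔
        Submodule.span ℤ {w : Ty A → ℤ | ∃ g : ZMod 2 × A, ∃ s ∈ squares A, w = transl A g (faceVec A s.1 s.2.1 s.2.2)} ∧
      (squares A).card + 1 = Fintype.card (OddDegreeParityLaw.OrbitsA A)) ∧
    ∀ S : Finset (Ty A → ℤ),
      hodge A ≤ pairs A ⊔ Submodule.span ℤ {w : Ty A → ℤ | ∃ g : ZMod 2 × A, ∃ v ∈ S, w = transl A g v} →
      (squares A).card ≤ S.card := by
  have h1 : 1 < Fintype.card A := by
    obtain ⟨m, hm⟩ := hA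
    have := Fintype.card_pos (α := A)
    omega
  refine ⟨⟨hodge_le_pairs_sup_span_squares_of_even A hA, card_squares_add_one A h1⟩, fun S hS => ?_⟩
  have := card_orbitsA_le_card_add_one A S hS
  have := card_squares_add_one A h1
  omega

end Summit.HodgeConjecture.CorCM.Census.EvenSliceLaw
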